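import Summits.ABC.IUTFork.Repair.RHHeightClassSigmaLicence
import Summits.ABC.IUTFork.Conditional.AbcOfSigmaMassRecut
import HarnessLib

/-!
# R-H ROUND 2, Q1′/Q2 row 8 «heightclass» — the MASS FORM of the row-8 certificate (MIN-SLICE (ii) in kernel at σ := Σ₈, licence DISCHARGED):
# «off-Σ₈ `(j²−1)`-mass ≤ Tol_K at Szpiro-bad admissible data ∧ hregBad ⟹ abc (constant + 40K)», and the R14 recut of p475863's hull-free end

PROOF-ONLY file (0 definitions, 0 `Prop` facts, no instance, no notation; nothing re-typed) of the abc-iut cell, rung LADDER-ABC:A2.RP → A2.RESCUE.H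
(seat abc-iut-rp-m2 gen 7 = R-H k2 DESK hand #8, row 8). Companion of `Repair/RHHeightClassSigmaAbcRecut.lean` (p478785; there: `R_{Σ₈} = R_∅` and the
recuts of the `R_{Σ₈}`-form end). TAKES NO SIDE on [IUTchIII] Cor. 3.12 or on any author. Composition BY NAME of abc-iut-rh2-T-1's Q1′ (ii) RECUT endpoints
`Conditional.SigmaMass.abc_of_licenceOn_of_offTrivialMass_le_szpiroBad_hregBad` / `…_content_hregC` (`Conditional/AbcOfSigmaMassRecut.lean`; FREE stratum
`σ`, explicit 3 = [LIC] · [THR] · [CONE-cut]) at **`σ(T) := Σ₈(T) = RHHeightClassSigmaDoor.sigmaHBand (pilotDataOfK T.D T.K)`** (p470903) with the [LIC]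
binder SUPPLIED BY THE THEOREM `RHHeightClassSigmaLicence.licenceOn_sigmaHBand_pilotDataOfK_chosen` (p475508).

WHAT IS TYPED (Σ₈(X) = the cells `(i, p)` — plus every archimedean cell — where the band clause `(j²−1)·m_q(w) ≤ j·(e_w − r) + (1 − r)` holds at every bad
`w ∣ p`, `p` odd, uniform `e_w`, certified `r`, `j = i+1`: a CLOSED-FORM INITIAL SEGMENT of labels per place (MIN-SLICE (iv) law `j ≤ j₀(w)`);
`B_triv(σᶜ)` = abc-iut-rh2-T-1's `RH.SigmaMass.offTrivialMass`, `mass(σ)` = `onTrivialMass`, `M` = `totalTrivialMass`, `Tol_K(P,l) = ((l+1)/4)·5·(d*·l + K)`):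
* §1 **`offTrivialMass_settingPrVolSharp_eq_offPilotGap`** — at the genuine bed with realising ideles, for ANY stratum `σ`, `B_triv(σᶜ)` IS the hull-free
  pilot-gap expression `PN(i ↦ Σᶠ_{(i,p) ∉ σ} ((i+1)²−1)·(−qLocal_{i+1,p}))` of p472500 / p475863 (cellwise `RH.SigmaMass.cellTrivialCost_settingPrVolSharp_eq`):
  the [TOL-TRIV] number of p475863 and the [THR] number of abc-iut-rh2-T-1 are ONE number — the one MIN-SLICE (i)/(iii) tabulates.
* §2 **`abc_of_offTrivialMass_sigmaHBand_le_szpiroBad_hregBad`** — explicit 2 = [THR-K-bad] «`B_triv(Σ₈(T)ᶜ) ≤ Tol_K(P,l)` at every genuine datum of every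
  SZPIRO-BAD admissible `(P, l)`» (⟺ «`mass(Σ₈(T)) ≥ M(T) − Tol_K`», `RH.SigmaMass.massThreshold_le_onTrivialMass_iff`) · [CONE-bad] `hregBad` (abc-iut-C-cert-2
  p452637 VERBATIM) ⟹ `ABC` (`C_K ↦ C_K + 40K`; `K = 0`: print's constants); **`abc_of_offTrivialMass_sigmaHBand_le_content_hregC`** — θ-CUT twin, [THR-C] ·
  [CONE-C] on the content locus only (`K = 0`); **`abc_of_offPilotGap_sigmaHBand_le_tol_szpiroBad_hregBad`** — the R14 RECUT of p475863's
  `abc_of_offPilotGap_sigmaHBand_le_tol` with its [TOL-TRIV] binder text AS IT WAS except the Szpiro-bad cut, [LIC]/[NUM, DEEP] gone, `hreg ↦ hregBad`.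
READING (neutral; rung currency A2.RESCUE.H, MIN-SLICE (ii) at row 8): «abc with the chain-of-record constants (+40K) follows AS TYPED from TWO displayed
hypotheses — ONE closed-form inequality per Szpiro-bad admissible window datum on the `(j²−1)`-mass of the cells OUTSIDE the height-class window, and the
cut cone binder; Σ₈'s own cells cost nothing (their licence is a kernel theorem) and no number-level Corollary is assumed anywhere». HONEST SCOPE: whether
genuine data meet [THR] is MIN-SLICE (iii)/(iv) / R-H READING v1.1 «Q1′ = Q3»: essentially iff the WHOLE datum lies in Σ₈, i.e. `l ≥ l₀(datum)` — below
`l₀` the binder FAILS (tables of record); NOT claimed here either way. COUNTS: every theorem WEAKER-OR-EQUAL binder by binder than p475863's / than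
abc-iut-rh2-T-1's free-σ ends at `σ := Σ₈` (one displayed hypothesis fewer), NO binder kernel-refuted (`Conditional.not_hreg_v4` does not elaborate against the
guarded texts). [THR]/[TOL-TRIV] are ASSUMPTION LABELS on defined numbers; Σ₈ / `HBand` are reading predicates (claim-tagged by their typers); «`ABC` follows
from these hypotheses AS TYPED», nothing more; nothing asserts abc proved or refuted, or that [IUTchIII] Cor. 3.12 / [IUTchIV] Thm. 1.10 holds or fails at
any datum; no side taken on Mochizuki / Scholze–Stix / Joshi / Dupuy–Hilado; refuted-as-typed ≠ refuted-in-print; typed ≠ proved; instantiated ≠ endorsed.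
[claim: Mochizuki2012, status: disputed] [cite: Mochizuki2012, IUTchIII Cor. 3.12 p. 173–174, Step (xi-f) p. 184, Prop. 3.9 (i)(iii) p. 116–117; IUTchIV
Thm. 1.10 pp. 22–31, Prop. 1.6 p. 16, Cor. 2.2 (ii)–(iii) pp. 41–48; IUTchI Ex. 3.2 (iv) p. 71] [cite: DupuyHilado2025, §3.3, §3.9, Thm. 3.10.1] Axioms: standard.
-/

noncomputable section

open Set Function NumberField IsDedekindDomain

namespace Summit.ABC.IUTFork.Repair.RHHeightClassSigmaAbc

open Summit.ABC.IUTFork.Thm311 Summit.ABC.IUTFork.Thm311.Real Summit.ABC.IUTFork.Cor312 Summit.ABC.IUTFork.Cor312.Setting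
  Summit.ABC.IUTFork.Cor312Vol Summit.ABC.IUTFork.Cor312Prov Literature.IUT.LogThetaLattice Literature.IUT.LogVolume
  Literature.IUT.HodgeTheaters Literature.IUT.LogVolume.ThetaData Literature.NumberTheory.NumberFields
  Literature.NumberTheory.GaloisRepresentations.Ultrametric
  Literature.NumberTheory.DiophantineGeometry.GenEll Summit.ABC.ABC.Theorems
  Summit.ABC.IUTFork.Repair.RH.SigmaLicence Summit.ABC.IUTFork.Repair.RH.SigmaStrataEq Summit.ABC.IUTFork.Repair.RH.SigmaMass
  Summit.ABC.IUTFork.Conditional Summit.ABC.IUTFork.Conditional.SigmaMass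

/-! ## §1. `B_triv(σᶜ)` at the bed IS the hull-free pilot gap -/

section Genuine

variable {F K Fbar : Type} [Field F] [NumberField F] [Field K] [NumberField K] [Algebra F K] [Field Fbar]
  [Algebra F Fbar] [Algebra K Fbar] {E : WeierstrassCurve F} [E.IsElliptic] {l : ℕ} {Pb : BadPlacePredicates K}
  (D : InitialThetaData F K Fbar E l Pb) (M : Type) [Field M] [NumberField M] {logv : PadicLogs K} (hlog : LogvAnalytic logv)
  (archPk : ∀ (j : (thetaIndex (pilotDataOfK D K)).Label) (vQ : (thetaIndex (pilotDataOfK D K)).VQ),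
    Set ((logShellsDH (pilotDataOfK D K) logv).Packet j vQ))
  (archSub : ∀ (j : (thetaIndex (pilotDataOfK D K)).Label) (v : (thetaIndex (pilotDataOfK D K)).V),
    Set ((logShellsDH (pilotDataOfK D K) logv).Packet j ((thetaIndex (pilotDataOfK D K)).over v)))
  (Ψ : ℤ → ∀ v : (thetaIndex (pilotDataOfK D K)).V, v ∈ (thetaIndex (pilotDataOfK D K)).Vbad →
    Set ((logShellsDH (pilotDataOfK D K) logv).StarPacket v))
  (act : ℤ → ∀ v : (thetaIndex (pilotDataOfK D K)).V, v ∈ (thetaIndex (pilotDataOfK D K)).Vbad →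
    (logShellsDH (pilotDataOfK D K) logv).StarPacket v → Module.End ℚ ((logShellsDH (pilotDataOfK D K) logv).StarPacket v))
  (Mmod : ℤ → ∀ j : (thetaIndex (pilotDataOfK D K)).LabelStar, Set ((logShellsDH (pilotDataOfK D K) logv).GlobalPacket j.1))
  (region : ℤ → ∀ j : (thetaIndex (pilotDataOfK D K)).LabelStar, FinDivisor M → ∀ vQ : (thetaIndex (pilotDataOfK D K)).VQ,
    Set ((logShellsDH (pilotDataOfK D K) logv).Packet j.1 vQ))
  (n : ℤ) {HT : Type} {LogLink : HT → HT → Type} {IsFull : ∀ {s t : HT}, LogLink s t → Prop}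
  (lat : LGPGaussianLogThetaLattice LogLink IsFull)
  {Frd : Type} {IsoF : Frd → Frd → Type} {Ob : Frd → Type} {realify : Frd → Frd} {Strip : Type}
  {IsoS : Strip → Strip → Type}
  {Mv : ∀ v : (thetaIndex (pilotDataOfK D K)).V, v ∈ (thetaIndex (pilotDataOfK D K)).Vbad → Type} [∀ v h, Monoid (Mv v h)]
  (sig : GlobalLGPFrobenioidSignature (thetaIndex (pilotDataOfK D K)).lstar (thetaIndex (pilotDataOfK D K)).V
    (· ∈ (thetaIndex (pilotDataOfK D K)).Vbad) Frd IsoF Ob realify Strip IsoS Mv)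
  (split : SplittingMonoids Mv) {ObΔ : Type}
  {N : ∀ v : (thetaIndex (pilotDataOfK D K)).V, v ∈ (thetaIndex (pilotDataOfK D K)).Vbad → Type} [∀ v h, Monoid (N v h)]
  (qData : QPilotData ObΔ N)
  (tq : ∀ (pp : Nat.Primes) (x : (thetaIndex (pilotDataOfK D K)).Fibre (.inr pp)),
    haveI : Fact (pp : ℕ).Prime := ⟨pp.2⟩; kOf (pilotDataOfK D K) pp.1 x)
  (t : ∀ (pp : Nat.Primes) (_ : Fin (pilotDataOfK D K).lstar) (x : (thetaIndex (pilotDataOfK D K)).Fibre (.inr pp)),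
    haveI : Fact (pp : ℕ).Prime := ⟨pp.2⟩; kOf (pilotDataOfK D K) pp.1 x)
  (htq0 : ∀ pp x, tq pp x ≠ 0)
  (htq1 : ∀ (pp : Nat.Primes) (x : (thetaIndex (pilotDataOfK D K)).Fibre (.inr pp)),
    haveI : Fact (pp : ℕ).Prime := ⟨pp.2⟩; placeOf (pilotDataOfK D K) pp.1 x ∉ (pilotDataOfK D K).S → ‖tq pp x‖ = 1)

/-- **`B_triv(σᶜ)` IS THE HULL-FREE PILOT GAP at the bed** (any stratum `σ`, realising ideles): abc-iut-rh2-T-1's off-Σ trivial mass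
`RH.SigmaMass.offTrivialMass (settingPrVolSharp …) σ` equals p472500's expression `PN(i ↦ Σᶠ_{(i,p) ∉ σ} ((i+1)²−1)·(−qLocal_{i+1,p}))` — the
[TOL-TRIV] number of p475863 / §2 below, the quantity MIN-SLICE (i)/(iii) tabulates (`(1/l⋇)·Σ_{(j,p)∉σ}(j²−1)·|qLocal_p|`). Cellwise
`RH.SigmaMass.cellTrivialCost_settingPrVolSharp_eq`. [cite: DupuyHilado2025, §3.3, Thm. 3.10.1] [claim: Mochizuki2012, status: disputed] -/
theorem offTrivialMass_settingPrVolSharp_eq_offPilotGap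
    (ht0 : ∀ pp i x, t pp i x ≠ 0)
    (ht : ∀ (pp : Nat.Primes) (i : Fin (pilotDataOfK D K).lstar) (x : (thetaIndex (pilotDataOfK D K)).Fibre (.inr pp)),
      haveI : Fact (pp : ℕ).Prime := ⟨pp.2⟩
      Real.log ‖t pp i x‖ = -((pilotDataOfK D K).thetaPilot i (placeOf (pilotDataOfK D K) pp.1 x)) *
        logNorm K (placeOf (pilotDataOfK D K) pp.1 x) / localDegree K (placeOf (pilotDataOfK D K) pp.1 x))
    (htq : ∀ (pp : Nat.Primes) (x : (thetaIndex (pilotDataOfK D K)).Fibre (.inr pp)),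
      haveI : Fact (pp : ℕ).Prime := ⟨pp.2⟩
      Real.log ‖tq pp x‖ = -((pilotDataOfK D K).qPilot (placeOf (pilotDataOfK D K) pp.1 x)) *
        logNorm K (placeOf (pilotDataOfK D K) pp.1 x) / localDegree K (placeOf (pilotDataOfK D K) pp.1 x))
    (σ : Set (Fin (thetaIndex (pilotDataOfK D K)).lstar × (thetaIndex (pilotDataOfK D K)).VQ)) :
    offTrivialMass (settingPrVolSharp (pilotDataOfK D K) hlog M archPk archSub Ψ act Mmod region n lat sig split qData tq t htq0 htq1) σ =
      processionNormalized fun i : Fin (thetaIndex (pilotDataOfK D K)).lstar =>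
        ∑ᶠ vQ : (thetaIndex (pilotDataOfK D K)).VQ, σᶜ.indicator
          (fun c : Fin (thetaIndex (pilotDataOfK D K)).lstar × (thetaIndex (pilotDataOfK D K)).VQ =>
            Sum.elim (fun _ : Unit => (0 : ℝ))
              (fun pp : Nat.Primes => ((((c.1 : ℕ) : ℝ) + 1) ^ 2 - 1) *
                (-(settingPrVolSharp (pilotDataOfK D K) hlog M archPk archSub Ψ act Mmod region n lat sig split qData tq t htq0
                  htq1).qLocal (labelSucc c.1) (.inr pp))) c.2) (i, vQ) := by
  have hcost : cellTrivialCost (settingPrVolSharp (pilotDataOfK D K) hlog M archPk archSub Ψ act Mmod region n lat sig split qData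
      tq t htq0 htq1) =
      fun c : Fin (thetaIndex (pilotDataOfK D K)).lstar × (thetaIndex (pilotDataOfK D K)).VQ =>
        Sum.elim (fun _ : Unit => (0 : ℝ))
          (fun pp : Nat.Primes => ((((c.1 : ℕ) : ℝ) + 1) ^ 2 - 1) *
            (-(settingPrVolSharp (pilotDataOfK D K) hlog M archPk archSub Ψ act Mmod region n lat sig split qData tq t htq0
              htq1).qLocal (labelSucc c.1) (.inr pp))) c.2 :=
    funext (cellTrivialCost_settingPrVolSharp_eq (pilotDataOfK D K) hlog M archPk archSub Ψ act Mmod region n lat sig split qData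
      tq t htq0 htq1 ht0 ht htq)
  unfold offTrivialMass
  rw [hcost]

end Genuine

/-! ## §2. The ends at σ := Σ₈ — column data of the certificates ONCE, then the three ends -/

section Ends

variable
    (M : ∀ (P : NFPoint) (l : ℕ) (T : Cor22.ThetaVolumeDatumAt P l), Type) [∀ P l T, Field (M P l T)] [∀ P l T, NumberField (M P l T)]
    (archPk : ∀ (P : NFPoint) (l : ℕ) (T : Cor22.ThetaVolumeDatumAt P l), letI := T.instFieldF; letI := T.instNumberFieldF; letI := T.instAlgebraF; letI := T.instFieldK;
        letI := T.instNumberFieldK; letI := T.instAlgebraK; letI := T.instFieldFbar; letI := T.instAlgebraFbar;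
        letI := T.instAlgebraKFbar; letI := T.instIsElliptic;
      ∀ (j : (thetaIndex (pilotDataOfK T.D T.K)).Label) (vQ : (thetaIndex (pilotDataOfK T.D T.K)).VQ), Set ((logShellsDH (pilotDataOfK T.D T.K) (analyticLogv T.K)).Packet j vQ))
    (archSub : ∀ (P : NFPoint) (l : ℕ) (T : Cor22.ThetaVolumeDatumAt P l), letI := T.instFieldF; letI := T.instNumberFieldF; letI := T.instAlgebraF; letI := T.instFieldK;
        letI := T.instNumberFieldK; letI := T.instAlgebraK; letI := T.instFieldFbar; letI := T.instAlgebraFbar;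
        letI := T.instAlgebraKFbar; letI := T.instIsElliptic;
      ∀ (j : (thetaIndex (pilotDataOfK T.D T.K)).Label) (v : (thetaIndex (pilotDataOfK T.D T.K)).V), Set ((logShellsDH (pilotDataOfK T.D T.K) (analyticLogv T.K)).Packet j ((thetaIndex (pilotDataOfK T.D T.K)).over v)))
    (Ψ : ∀ (P : NFPoint) (l : ℕ) (T : Cor22.ThetaVolumeDatumAt P l), letI := T.instFieldF; letI := T.instNumberFieldF; letI := T.instAlgebraF; letI := T.instFieldK;
        letI := T.instNumberFieldK; letI := T.instAlgebraK; letI := T.instFieldFbar; letI := T.instAlgebraFbar;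
        letI := T.instAlgebraKFbar; letI := T.instIsElliptic;
      ℤ → ∀ v : (thetaIndex (pilotDataOfK T.D T.K)).V, v ∈ (thetaIndex (pilotDataOfK T.D T.K)).Vbad → Set ((logShellsDH (pilotDataOfK T.D T.K) (analyticLogv T.K)).StarPacket v))
    (act : ∀ (P : NFPoint) (l : ℕ) (T : Cor22.ThetaVolumeDatumAt P l), letI := T.instFieldF; letI := T.instNumberFieldF; letI := T.instAlgebraF; letI := T.instFieldK;
        letI := T.instNumberFieldK; letI := T.instAlgebraK; letI := T.instFieldFbar; letI := T.instAlgebraFbar;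
        letI := T.instAlgebraKFbar; letI := T.instIsElliptic;
      ℤ → ∀ v : (thetaIndex (pilotDataOfK T.D T.K)).V, v ∈ (thetaIndex (pilotDataOfK T.D T.K)).Vbad → (logShellsDH (pilotDataOfK T.D T.K) (analyticLogv T.K)).StarPacket v → Module.End ℚ ((logShellsDH (pilotDataOfK T.D T.K) (analyticLogv T.K)).StarPacket v))
    (Mmod : ∀ (P : NFPoint) (l : ℕ) (T : Cor22.ThetaVolumeDatumAt P l), letI := T.instFieldF; letI := T.instNumberFieldF; letI := T.instAlgebraF; letI := T.instFieldK;
        letI := T.instNumberFieldK; letI := T.instAlgebraK; letI := T.instFieldFbar; letI := T.instAlgebraFbar;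
        letI := T.instAlgebraKFbar; letI := T.instIsElliptic;
      ℤ → ∀ j : (thetaIndex (pilotDataOfK T.D T.K)).LabelStar, Set ((logShellsDH (pilotDataOfK T.D T.K) (analyticLogv T.K)).GlobalPacket j.1))
    (region : ∀ (P : NFPoint) (l : ℕ) (T : Cor22.ThetaVolumeDatumAt P l), letI := T.instFieldF; letI := T.instNumberFieldF; letI := T.instAlgebraF; letI := T.instFieldK;
        letI := T.instNumberFieldK; letI := T.instAlgebraK; letI := T.instFieldFbar; letI := T.instAlgebraFbar;
        letI := T.instAlgebraKFbar; letI := T.instIsElliptic;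
      ℤ → ∀ j : (thetaIndex (pilotDataOfK T.D T.K)).LabelStar, FinDivisor (M P l T) → ∀ vQ : (thetaIndex (pilotDataOfK T.D T.K)).VQ, Set ((logShellsDH (pilotDataOfK T.D T.K) (analyticLogv T.K)).Packet j.1 vQ))
    (n : ∀ (P : NFPoint) (l : ℕ) (T : Cor22.ThetaVolumeDatumAt P l), ℤ)
    {HT : ∀ (P : NFPoint) (l : ℕ) (T : Cor22.ThetaVolumeDatumAt P l), Type} {LogLink : ∀ (P : NFPoint) (l : ℕ) (T : Cor22.ThetaVolumeDatumAt P l), HT P l T → HT P l T → Type}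
    {IsFull : ∀ (P : NFPoint) (l : ℕ) (T : Cor22.ThetaVolumeDatumAt P l), ∀ {s t : HT P l T}, LogLink P l T s t → Prop}
    (lat : ∀ (P : NFPoint) (l : ℕ) (T : Cor22.ThetaVolumeDatumAt P l), LGPGaussianLogThetaLattice (LogLink P l T) (IsFull P l T))
    {Frd : ∀ (P : NFPoint) (l : ℕ) (T : Cor22.ThetaVolumeDatumAt P l), Type} {IsoF : ∀ (P : NFPoint) (l : ℕ) (T : Cor22.ThetaVolumeDatumAt P l), Frd P l T → Frd P l T → Type} {Ob : ∀ (P : NFPoint) (l : ℕ) (T : Cor22.ThetaVolumeDatumAt P l), Frd P l T → Type}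
    {realify : ∀ (P : NFPoint) (l : ℕ) (T : Cor22.ThetaVolumeDatumAt P l), Frd P l T → Frd P l T} {Strip : ∀ (P : NFPoint) (l : ℕ) (T : Cor22.ThetaVolumeDatumAt P l), Type} {IsoS : ∀ (P : NFPoint) (l : ℕ) (T : Cor22.ThetaVolumeDatumAt P l), Strip P l T → Strip P l T → Type}
    {Mv : ∀ (P : NFPoint) (l : ℕ) (T : Cor22.ThetaVolumeDatumAt P l), letI := T.instFieldF; letI := T.instNumberFieldF; letI := T.instAlgebraF; letI := T.instFieldK;
        letI := T.instNumberFieldK; letI := T.instAlgebraK; letI := T.instFieldFbar; letI := T.instAlgebraFbar;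
        letI := T.instAlgebraKFbar; letI := T.instIsElliptic;
      ∀ v : (thetaIndex (pilotDataOfK T.D T.K)).V, v ∈ (thetaIndex (pilotDataOfK T.D T.K)).Vbad → Type}
    [∀ P l T v h, Monoid (Mv P l T v h)]
    (sig : ∀ (P : NFPoint) (l : ℕ) (T : Cor22.ThetaVolumeDatumAt P l), letI := T.instFieldF; letI := T.instNumberFieldF; letI := T.instAlgebraF; letI := T.instFieldK;
        letI := T.instNumberFieldK; letI := T.instAlgebraK; letI := T.instFieldFbar; letI := T.instAlgebraFbar;
        letI := T.instAlgebraKFbar; letI := T.instIsElliptic;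
      GlobalLGPFrobenioidSignature (thetaIndex (pilotDataOfK T.D T.K)).lstar (thetaIndex (pilotDataOfK T.D T.K)).V (· ∈ (thetaIndex (pilotDataOfK T.D T.K)).Vbad) (Frd P l T) (IsoF P l T) (Ob P l T) (realify P l T)
        (Strip P l T) (IsoS P l T) (Mv P l T))
    (split : ∀ (P : NFPoint) (l : ℕ) (T : Cor22.ThetaVolumeDatumAt P l), SplittingMonoids (Mv P l T))
    {ObΔ : ∀ (P : NFPoint) (l : ℕ) (T : Cor22.ThetaVolumeDatumAt P l), Type} {N : ∀ (P : NFPoint) (l : ℕ) (T : Cor22.ThetaVolumeDatumAt P l), letI := T.instFieldF; letI := T.instNumberFieldF; letI := T.instAlgebraF; letI := T.instFieldK;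
        letI := T.instNumberFieldK; letI := T.instAlgebraK; letI := T.instFieldFbar; letI := T.instAlgebraFbar;
        letI := T.instAlgebraKFbar; letI := T.instIsElliptic;
      ∀ v : (thetaIndex (pilotDataOfK T.D T.K)).V, v ∈ (thetaIndex (pilotDataOfK T.D T.K)).Vbad → Type}
    [∀ P l T v h, Monoid (N P l T v h)] (qData : ∀ (P : NFPoint) (l : ℕ) (T : Cor22.ThetaVolumeDatumAt P l), QPilotData (ObΔ P l T) (N P l T))

include M archPk archSub Ψ act Mmod region n lat sig split qData

/-- **`abc_of_offTrivialMass_sigmaHBand_le_szpiroBad_hregBad` — MIN-SLICE (ii) AT ROW 8, LICENCE DISCHARGED (Szpiro-bad recut).** For a budget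
`K ≥ 0`: explicit 2 = [THR-K-bad] «at every SZPIRO-BAD admissible `(P, l)` and every genuine Θ-volume datum `T`, the `(j²−1)`-mass of the cells OUTSIDE
the height-class window is within the budgeted tolerance, `B_triv(Σ₈(T)ᶜ) ≤ ((l+1)/4)·5·(d*·l + K)`» (⟺ `mass(Σ₈(T)) ≥ M(T) − Tol_K`,
`RH.SigmaMass.massThreshold_le_onTrivialMass_iff`; §1: the hull-free pilot-gap number) · [CONE-bad] `hregBad` (abc-iut-C-cert-2 p452637 VERBATIM) ⟹ `ABC`
(`C_K ↦ C_K + 40K`; `K = 0`: print's constants) — abc-iut-rh2-T-1's `SigmaMass.abc_of_licenceOn_of_offTrivialMass_le_szpiroBad_hregBad` at `σ := Σ₈` with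
`hLic := licenceOn_sigmaHBand_pilotDataOfK_chosen` (p475508, a THEOREM at every datum). At Szpiro-good admissible points NOTHING is assumed; no binder is
kernel-refuted. HONEST SCOPE: [THR] FAILS on genuine data below `l₀(datum)` (MIN-SLICE (iii)/(iv)); not claimed either way. CONDITIONAL; «`ABC` follows from
these hypotheses AS TYPED», nothing more; no side taken on [IUTchIII] Cor. 3.12. [cite: Mochizuki2012, IUTchIV Thm. 1.10 pp. 22–31; Prop. 1.6 p. 16;
Cor. 2.2 (ii)–(iii) pp. 41–48] [cite: Mochizuki2012, IUTchIII Cor. 3.12 p. 174] [claim: Mochizuki2012, status: disputed] -/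
theorem abc_of_offTrivialMass_sigmaHBand_le_szpiroBad_hregBad {K : ℝ} (hK : 0 ≤ K)
    -- [THR-K, Szpiro-bad] the off-Σ₈ trivial mass within the budgeted tolerance `Tol_K(P,l)`, at Szpiro-bad admissible data
    (hThrBad : ∀ P : NFPoint, P ∈ UP → ∀ l : ℕ, l.Prime → 5 ≤ l →
      Cor22.AdmitsCore P → Cor22.CondP2 P l → Cor22.CondP5 P l → Cor22.CondP6 P l →
      (((l : ℝ) + 5) / 4 < (Cor22.dmod P : ℝ) ∨
        6 * l * (((l : ℝ) + 5) - 4 * Cor22.dmod P) / (((l : ℝ) + 4) * ((l : ℝ) - 3))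
            * (P.logDiff + (1 - 1 / (l : ℝ)) * Cor22.logCondAvoid P {2, l})
          + 6 * l * ((l : ℝ) + 5) / (((l : ℝ) + 4) * ((l : ℝ) - 3)) * Real.log Real.pi < Cor22.logQAvoid P {2, l}) →
      ∀ T : Cor22.ThetaVolumeDatumAt P l, letI := T.instFieldF; letI := T.instNumberFieldF; letI := T.instAlgebraF; letI := T.instFieldK;
        letI := T.instNumberFieldK; letI := T.instAlgebraK; letI := T.instFieldFbar; letI := T.instAlgebraFbar;
        letI := T.instAlgebraKFbar; letI := T.instIsElliptic;
      offTrivialMass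
        (settingPrVolSharp (pilotDataOfK T.D T.K) (logvAnalytic_analyticLogv (F := T.K)) (M P l T) (archPk P l T) (archSub P l T) (Ψ P l T)
          (act P l T) (Mmod P l T) (region P l T) (n P l T) (lat P l T) (sig P l T) (split P l T) (qData P l T)
          (exists_realising_qIdeles_pilotDataOfK T.D).choose
          (exists_realising_thetaIdeles_pilotDataOfK T.D).choose
          (exists_realising_qIdeles_pilotDataOfK T.D).choose_spec.1
          (exists_realising_qIdeles_pilotDataOfK T.D).choose_spec.2.1) (RHHeightClassSigmaDoor.sigmaHBand (pilotDataOfK T.D T.K)) ≤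
        ((l : ℝ) + 1) / 4 * (5 * ((((2 ^ 12 * 3 ^ 3 * 5 * Cor22.dmod P : ℕ) : ℝ)) * l + K)))
    -- [CONE, Szpiro-bad] `hregBad`, p452637 VERBATIM
    (hregBad : ∀ P : NFPoint, P ∈ UP → ∀ l : ℕ, l.Prime → 5 ≤ l →
      Cor22.AdmitsCore P → Cor22.CondP2 P l → Cor22.CondP5 P l → Cor22.CondP6 P l →
      (((l : ℝ) + 5) / 4 < (Cor22.dmod P : ℝ) ∨
        6 * l * (((l : ℝ) + 5) - 4 * Cor22.dmod P) / (((l : ℝ) + 4) * ((l : ℝ) - 3))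
            * (P.logDiff + (1 - 1 / (l : ℝ)) * Cor22.logCondAvoid P {2, l})
          + 6 * l * ((l : ℝ) + 5) / (((l : ℝ) + 4) * ((l : ℝ) - 3)) * Real.log Real.pi < Cor22.logQAvoid P {2, l}) →
      ∀ T : Cor22.ThetaVolumeDatumAt P l,
        (letI := T.instFieldF; letI := T.instNumberFieldF; letI := T.instAlgebraF; letI := T.instFieldK
         letI := T.instNumberFieldK; letI := T.instAlgebraK; letI := T.instFieldFbar; letI := T.instAlgebraFbar
         letI := T.instAlgebraKFbar; letI := T.instIsElliptic
         ¬ (∀ p ∈ T.I.supportPrimes, ∀ v w : placesOver (fieldOfModuli T.E) p,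
            (Summit.ABC.IUTFork.DHData.ofInput T.I).logQloc p v = (Summit.ABC.IUTFork.DHData.ofInput T.I).logQloc p w)) →
        T.HullEstimateOf
          (((l : ℝ) + 1) / 4 *
            ((1 + 12 * (Cor22.dmod P : ℝ) / l) * (P.logDiff + Cor22.logCondAvoid P {2, l})
              + 2 * Real.log l + 52
              + 20 / 3 * Real.log (((2 ^ 12 * 3 ^ 3 * 5 * Cor22.dmod P : ℕ) : ℝ) * (l : ℝ))
                * (Nat.primeCounting (2 ^ 12 * 3 ^ 3 * 5 * Cor22.dmod P * l) : ℝ)))) :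
    _root_.ABC :=
  SigmaMass.abc_of_licenceOn_of_offTrivialMass_le_szpiroBad_hregBad hK M archPk archSub Ψ act Mmod region n lat sig split qData
    (fun P l T =>
      letI := T.instFieldF; letI := T.instNumberFieldF; letI := T.instAlgebraF; letI := T.instFieldK
      letI := T.instNumberFieldK; letI := T.instAlgebraK; letI := T.instFieldFbar; letI := T.instAlgebraFbar
      letI := T.instAlgebraKFbar; letI := T.instIsElliptic
      RHHeightClassSigmaDoor.sigmaHBand (pilotDataOfK T.D T.K))
    (fun P _ l _ _ _ _ _ _ _ T => by
      letI := T.instFieldF; letI := T.instNumberFieldF; letI := T.instAlgebraF; letI := T.instFieldK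
      letI := T.instNumberFieldK; letI := T.instAlgebraK; letI := T.instFieldFbar; letI := T.instAlgebraFbar
      letI := T.instAlgebraKFbar; letI := T.instIsElliptic
      exact RHHeightClassSigmaLicence.licenceOn_sigmaHBand_pilotDataOfK_chosen T.D (M P l T) (archPk P l T) (archSub P l T) (Ψ P l T)
        (act P l T) (Mmod P l T) (region P l T) (n P l T) (lat P l T) (sig P l T) (split P l T) (qData P l T))
    hThrBad hregBad

/-- **`abc_of_offTrivialMass_sigmaHBand_le_content_hregC` — the θ-CUT twin (director-abc R14′: the content socket), `K = 0`.** Explicit 2 = [THR-C]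
«`B_triv(Σ₈(T)ᶜ) ≤ Tol(P,l) = ((l+1)/4)·5·d*·l` at the genuine data of admissible `(P, l)` ON THE CONTENT LOCUS `6(1 + 20 d_mod/l)(log-diff + log-cond) +
120·d*·l < log q^{∤{2,l}}(λ)` of [IUTchIV] Thm. 1.10's display» · [CONE-C] `hregC` (abc-iut-C-cert-1's `ABC_of_cor312C_of_hullRegimeC` binder VERBATIM) ⟹
`ABC` — abc-iut-rh2-T-1's `SigmaMass.abc_of_licenceOn_of_offTrivialMass_le_content_hregC` at `σ := Σ₈`, licence discharged. Binder by binder WEAKER-OR-EQUAL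
than the Szpiro-bad form (`szpiroBad_of_content`); off the content locus NOTHING is assumed. CONDITIONAL; nothing asserted about the hypotheses; no side
taken. [cite: Mochizuki2012, IUTchIV Thm. 1.10 pp. 22–31; Cor. 2.2 (ii) pp. 41–48] [cite: Mochizuki2012, IUTchIII Cor. 3.12 p. 174] [claim: Mochizuki2012, status: disputed] -/
theorem abc_of_offTrivialMass_sigmaHBand_le_content_hregC
    -- [THR, content locus] the off-Σ₈ trivial mass within the no-loss tolerance `Tol(P,l)`, at the data of admissible points on the content locus
    (hThrC : ∀ P : NFPoint, P ∈ UP → ∀ l : ℕ, l.Prime → 5 ≤ l →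
      Cor22.AdmitsCore P → Cor22.CondP2 P l → Cor22.CondP5 P l → Cor22.CondP6 P l →
      6 * ((1 + 20 * (Cor22.dmod P : ℝ) / l) * (P.logDiff + Cor22.logCondAvoid P {2, l}))
          + 120 * (2 ^ 12 * 3 ^ 3 * 5 * (Cor22.dmod P : ℝ) * l) < Cor22.logQAvoid P {2, l} →
      ∀ T : Cor22.ThetaVolumeDatumAt P l, letI := T.instFieldF; letI := T.instNumberFieldF; letI := T.instAlgebraF; letI := T.instFieldK;
        letI := T.instNumberFieldK; letI := T.instAlgebraK; letI := T.instFieldFbar; letI := T.instAlgebraFbar;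
        letI := T.instAlgebraKFbar; letI := T.instIsElliptic;
      offTrivialMass
        (settingPrVolSharp (pilotDataOfK T.D T.K) (logvAnalytic_analyticLogv (F := T.K)) (M P l T) (archPk P l T) (archSub P l T) (Ψ P l T)
          (act P l T) (Mmod P l T) (region P l T) (n P l T) (lat P l T) (sig P l T) (split P l T) (qData P l T)
          (exists_realising_qIdeles_pilotDataOfK T.D).choose
          (exists_realising_thetaIdeles_pilotDataOfK T.D).choose
          (exists_realising_qIdeles_pilotDataOfK T.D).choose_spec.1
          (exists_realising_qIdeles_pilotDataOfK T.D).choose_spec.2.1) (RHHeightClassSigmaDoor.sigmaHBand (pilotDataOfK T.D T.K)) ≤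
        ((l : ℝ) + 1) / 4 * (5 * ((((2 ^ 12 * 3 ^ 3 * 5 * Cor22.dmod P : ℕ) : ℝ)) * l)))
    -- [CONE, content locus] `hregC`, abc-iut-C-cert-1's binder VERBATIM
    (hregC : ∀ P : NFPoint, P ∈ UP → ∀ l : ℕ, l.Prime → 5 ≤ l →
      Cor22.AdmitsCore P → Cor22.CondP2 P l → Cor22.CondP5 P l → Cor22.CondP6 P l →
      6 * ((1 + 20 * (Cor22.dmod P : ℝ) / l) * (P.logDiff + Cor22.logCondAvoid P {2, l}))
          + 120 * (2 ^ 12 * 3 ^ 3 * 5 * (Cor22.dmod P : ℝ) * l) < Cor22.logQAvoid P {2, l} →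
      ∀ T : Cor22.ThetaVolumeDatumAt P l,
        (letI := T.instFieldF; letI := T.instNumberFieldF; letI := T.instAlgebraF; letI := T.instFieldK
         letI := T.instNumberFieldK; letI := T.instAlgebraK; letI := T.instFieldFbar; letI := T.instAlgebraFbar
         letI := T.instAlgebraKFbar; letI := T.instIsElliptic
         ¬ (∀ p ∈ T.I.supportPrimes, ∀ v w : placesOver (fieldOfModuli T.E) p,
            (Summit.ABC.IUTFork.DHData.ofInput T.I).logQloc p v = (Summit.ABC.IUTFork.DHData.ofInput T.I).logQloc p w)) →
        T.HullEstimateOf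
          (((l : ℝ) + 1) / 4 *
            ((1 + 12 * (Cor22.dmod P : ℝ) / l) * (P.logDiff + Cor22.logCondAvoid P {2, l})
              + 2 * Real.log l + 52
              + 20 / 3 * Real.log (((2 ^ 12 * 3 ^ 3 * 5 * Cor22.dmod P : ℕ) : ℝ) * (l : ℝ))
                * (Nat.primeCounting (2 ^ 12 * 3 ^ 3 * 5 * Cor22.dmod P * l) : ℝ)))) :
    _root_.ABC :=
  SigmaMass.abc_of_licenceOn_of_offTrivialMass_le_content_hregC M archPk archSub Ψ act Mmod region n lat sig split qData
    (fun P l T =>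
      letI := T.instFieldF; letI := T.instNumberFieldF; letI := T.instAlgebraF; letI := T.instFieldK
      letI := T.instNumberFieldK; letI := T.instAlgebraK; letI := T.instFieldFbar; letI := T.instAlgebraFbar
      letI := T.instAlgebraKFbar; letI := T.instIsElliptic
      RHHeightClassSigmaDoor.sigmaHBand (pilotDataOfK T.D T.K))
    (fun P _ l _ _ _ _ _ _ _ T => by
      letI := T.instFieldF; letI := T.instNumberFieldF; letI := T.instAlgebraF; letI := T.instFieldK
      letI := T.instNumberFieldK; letI := T.instAlgebraK; letI := T.instFieldFbar; letI := T.instAlgebraFbar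
      letI := T.instAlgebraKFbar; letI := T.instIsElliptic
      exact RHHeightClassSigmaLicence.licenceOn_sigmaHBand_pilotDataOfK_chosen T.D (M P l T) (archPk P l T) (archSub P l T) (Ψ P l T)
        (act P l T) (Mmod P l T) (region P l T) (n P l T) (lat P l T) (sig P l T) (split P l T) (qData P l T))
    hThrC hregC

/-- **`abc_of_offPilotGap_sigmaHBand_le_tol_szpiroBad_hregBad` — R14 RECUT of p475863's HULL-FREE end `abc_of_offPilotGap_sigmaHBand_le_tol`.**
Explicit 2 = [TOL-TRIV-bad] «the off-Σ₈ PILOT GAP `PN(i ↦ Σᶠ_{(i,p) ∉ Σ₈(T)} ((i+1)²−1)·|qLocal_{i+1,p}|) ≤ ((l+1)/4)·5·d*·l` at every genuine datum of every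
SZPIRO-BAD admissible `(P, l)`» — the binder text of p475863 AS IT WAS except the Szpiro-bad cut (= §1's `B_triv(Σ₈ᶜ)`, i.e. the `K = 0` case of
`abc_of_offTrivialMass_sigmaHBand_le_szpiroBad_hregBad` in p472500's spelling, along §1's identity) · [CONE-bad] `hregBad` ⟹ `ABC`; [LIC] a
theorem, [NUM, DEEP] gone. CONDITIONAL; whether genuine Szpiro-bad data meet [TOL-TRIV] is MIN-SLICE
(iii)/(iv) — NOT claimed; no side taken. [cite: Mochizuki2012, IUTchIV Thm. 1.10 pp. 22–31; IUTchIII Cor. 3.12 p. 174] [cite: DupuyHilado2025, §3.3, Thm. 3.10.1]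
[claim: Mochizuki2012, status: disputed] -/
theorem abc_of_offPilotGap_sigmaHBand_le_tol_szpiroBad_hregBad
    -- [TOL-TRIV, Szpiro-bad] the off-Σ₈ PILOT GAP (hull-free) is within q2-cond's tolerance, at Szpiro-bad admissible data
    (hTrivBad : ∀ P : NFPoint, P ∈ UP → ∀ l : ℕ, l.Prime → 5 ≤ l →
      Cor22.AdmitsCore P → Cor22.CondP2 P l → Cor22.CondP5 P l → Cor22.CondP6 P l →
      (((l : ℝ) + 5) / 4 < (Cor22.dmod P : ℝ) ∨
        6 * l * (((l : ℝ) + 5) - 4 * Cor22.dmod P) / (((l : ℝ) + 4) * ((l : ℝ) - 3))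
            * (P.logDiff + (1 - 1 / (l : ℝ)) * Cor22.logCondAvoid P {2, l})
          + 6 * l * ((l : ℝ) + 5) / (((l : ℝ) + 4) * ((l : ℝ) - 3)) * Real.log Real.pi < Cor22.logQAvoid P {2, l}) →
      ∀ T : Cor22.ThetaVolumeDatumAt P l, letI := T.instFieldF; letI := T.instNumberFieldF; letI := T.instAlgebraF; letI := T.instFieldK;
        letI := T.instNumberFieldK; letI := T.instAlgebraK; letI := T.instFieldFbar; letI := T.instAlgebraFbar;
        letI := T.instAlgebraKFbar; letI := T.instIsElliptic;
      (processionNormalized fun i : Fin (thetaIndex (pilotDataOfK T.D T.K)).lstar =>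
        ∑ᶠ vQ : (thetaIndex (pilotDataOfK T.D T.K)).VQ, (RHHeightClassSigmaDoor.sigmaHBand (pilotDataOfK T.D T.K))ᶜ.indicator
          (fun c : Fin (thetaIndex (pilotDataOfK T.D T.K)).lstar × (thetaIndex (pilotDataOfK T.D T.K)).VQ =>
            Sum.elim (fun _ : Unit => (0 : ℝ))
              (fun pp : Nat.Primes => ((((c.1 : ℕ) : ℝ) + 1) ^ 2 - 1) *
                (-(settingPrVolSharp (pilotDataOfK T.D T.K) (logvAnalytic_analyticLogv (F := T.K)) (M P l T) (archPk P l T) (archSub P l T) (Ψ P l T)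
          (act P l T) (Mmod P l T) (region P l T) (n P l T) (lat P l T) (sig P l T) (split P l T) (qData P l T)
          (exists_realising_qIdeles_pilotDataOfK T.D).choose
          (exists_realising_thetaIdeles_pilotDataOfK T.D).choose
          (exists_realising_qIdeles_pilotDataOfK T.D).choose_spec.1
          (exists_realising_qIdeles_pilotDataOfK T.D).choose_spec.2.1).qLocal
                  (labelSucc c.1) (.inr pp))) c.2) (i, vQ)) ≤
        ((l : ℝ) + 1) / 4 * (5 * ((((2 ^ 12 * 3 ^ 3 * 5 * Cor22.dmod P : ℕ) : ℝ)) * l)))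
    -- [CONE, Szpiro-bad] `hregBad`, p452637 VERBATIM
    (hregBad : ∀ P : NFPoint, P ∈ UP → ∀ l : ℕ, l.Prime → 5 ≤ l →
      Cor22.AdmitsCore P → Cor22.CondP2 P l → Cor22.CondP5 P l → Cor22.CondP6 P l →
      (((l : ℝ) + 5) / 4 < (Cor22.dmod P : ℝ) ∨
        6 * l * (((l : ℝ) + 5) - 4 * Cor22.dmod P) / (((l : ℝ) + 4) * ((l : ℝ) - 3))
            * (P.logDiff + (1 - 1 / (l : ℝ)) * Cor22.logCondAvoid P {2, l})
          + 6 * l * ((l : ℝ) + 5) / (((l : ℝ) + 4) * ((l : ℝ) - 3)) * Real.log Real.pi < Cor22.logQAvoid P {2, l}) →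
      ∀ T : Cor22.ThetaVolumeDatumAt P l,
        (letI := T.instFieldF; letI := T.instNumberFieldF; letI := T.instAlgebraF; letI := T.instFieldK
         letI := T.instNumberFieldK; letI := T.instAlgebraK; letI := T.instFieldFbar; letI := T.instAlgebraFbar
         letI := T.instAlgebraKFbar; letI := T.instIsElliptic
         ¬ (∀ p ∈ T.I.supportPrimes, ∀ v w : placesOver (fieldOfModuli T.E) p,
            (Summit.ABC.IUTFork.DHData.ofInput T.I).logQloc p v = (Summit.ABC.IUTFork.DHData.ofInput T.I).logQloc p w)) →
        T.HullEstimateOf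
          (((l : ℝ) + 1) / 4 *
            ((1 + 12 * (Cor22.dmod P : ℝ) / l) * (P.logDiff + Cor22.logCondAvoid P {2, l})
              + 2 * Real.log l + 52
              + 20 / 3 * Real.log (((2 ^ 12 * 3 ^ 3 * 5 * Cor22.dmod P : ℕ) : ℝ) * (l : ℝ))
                * (Nat.primeCounting (2 ^ 12 * 3 ^ 3 * 5 * Cor22.dmod P * l) : ℝ)))) :
    _root_.ABC :=
  -- the `K = 0` mass end, its [THR] binder rewritten along §1's identity `B_triv(Σ₈ᶜ) =` off-Σ₈ pilot gap
  abc_of_offTrivialMass_sigmaHBand_le_szpiroBad_hregBad M archPk archSub Ψ act Mmod region n lat sig split qData (K := 0) le_rfl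
    (fun P hP l hl h5 hc h2 h5' h6 hg T => by
      letI := T.instFieldF; letI := T.instNumberFieldF; letI := T.instAlgebraF; letI := T.instFieldK
      letI := T.instNumberFieldK; letI := T.instAlgebraK; letI := T.instFieldFbar; letI := T.instAlgebraFbar
      letI := T.instAlgebraKFbar; letI := T.instIsElliptic
      exact (offTrivialMass_settingPrVolSharp_eq_offPilotGap T.D (M P l T) (logvAnalytic_analyticLogv (F := T.K)) (archPk P l T)
        (archSub P l T) (Ψ P l T) (act P l T) (Mmod P l T) (region P l T) (n P l T) (lat P l T) (sig P l T) (split P l T) (qData P l T)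
        (exists_realising_qIdeles_pilotDataOfK T.D).choose (exists_realising_thetaIdeles_pilotDataOfK T.D).choose
        (exists_realising_qIdeles_pilotDataOfK T.D).choose_spec.1 (exists_realising_qIdeles_pilotDataOfK T.D).choose_spec.2.1
        (exists_realising_thetaIdeles_pilotDataOfK T.D).choose_spec.1 (exists_realising_thetaIdeles_pilotDataOfK T.D).choose_spec.2.2
        (exists_realising_qIdeles_pilotDataOfK T.D).choose_spec.2.2 (RHHeightClassSigmaDoor.sigmaHBand (pilotDataOfK T.D T.K))).trans_le
        ((hTrivBad P hP l hl h5 hc h2 h5' h6 hg T).trans_eq (by rw [add_zero])))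
    hregBad

end Ends

end Summit.ABC.IUTFork.Repair.RHHeightClassSigmaAbc

end
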